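import Literature.AlgebraicGeometry.HodgeTheory.FermatHodgeCharacterGlobal
import Mathlib.NumberTheory.DirichletCharacter.Bounds
import HarnessLib

/-!
# Sums of roots of unity and characters with prescribed values (support for Aoki 1983, §8)

Support file VII (everything PROVED; no named facts, no definitions) for the structure theorem of
the Hodge characters of the Fermat surface (`AokiShioda1983_thmB2m_standard`).

* `cube_of_add_three_eq_zero` — three complex numbers of modulus `1` summing to `0` are
  `z, zω, zω²` (`ω` a primitive cube root of unity);
* `mul_add_eq_zero_of_add_four_eq_zero` — four complex numbers of modulus `1` summing to `0`
  form two antipodal pairs: `(z₁ + z₂)(z₁ + z₃)(z₁ + z₄) = 0`;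
* `card_filter_apply_eq` — **fibre counting**: for `h ∈ (ℤ/N)ˣ` of order `n` and `zⁿ = 1`,
  exactly `φ(N)/n` Dirichlet characters mod `N` take the value `z` at `h`;
* `card_filter_factorsThrough` — exactly `φ(d)` characters mod `N` factor through `d ∣ N`;
* `exists_apply_eq_not_factorsThrough` — hence a character with `χ(h) = z` not factoring
  through `d` exists as soon as `n φ(d) < φ(N)`;
* `exists_isPrimitive_neg_one_apply_cube` — at an odd prime power `q = p^e` with
  `6 φ(p^(e-1)) < φ(q)`: primitive characters with prescribed parity AND prescribed value (a
  cube root of unity) at a given element of order `3`.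

These are the tools for the length-`3` and length-`4` elements of Aoki's ideals `A(f)`
([Aoki1983, Props. 8.1, 8.2]) via values of characters instead of Aoki's normalized expansions.

## References

* [Aoki1983] N. Aoki, On some arithmetic problems related to the Hodge cycles on the Fermat
  varieties, Math. Ann. 266 (1983) 23–54, §8 (text read).
-/

noncomputable section

open Finset

namespace Literature.AlgebraicGeometry.HodgeTheory

namespace FermatCharacter

/-! ### Sums of complex numbers of modulus one -/

open ComplexConjugate in
/-- **Three unit complex numbers summing to zero** are `z, zω, zω²`: with `w = z₂/z₁`,
`w² + w + 1 = 0` and `z₃/z₁ = w²`. [folklore] -/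
theorem cube_of_add_three_eq_zero {z₁ z₂ z₃ : ℂ} (h1 : ‖z₁‖ = 1) (h2 : ‖z₂‖ = 1)
    (h3 : ‖z₃‖ = 1) (h : z₁ + z₂ + z₃ = 0) :
    (z₂ * z₁⁻¹) ^ 2 + z₂ * z₁⁻¹ + 1 = 0 ∧ z₃ * z₁⁻¹ = (z₂ * z₁⁻¹) ^ 2 := by
  have hz1 : z₁ ≠ 0 := fun h0 ↦ by rw [h0, norm_zero] at h1; exact zero_ne_one h1
  set w := z₂ * z₁⁻¹ with hw
  set w' := z₃ * z₁⁻¹ with hw'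
  have hwn : ‖w‖ = 1 := by rw [hw, norm_mul, norm_inv, h1, h2]; norm_num
  have hwn' : ‖w'‖ = 1 := by rw [hw', norm_mul, norm_inv, h1, h3]; norm_num
  have e1 : 1 + w + w' = 0 := by
    have := congrArg (· * z₁⁻¹) h
    simp only [add_mul, zero_mul, mul_inv_cancel₀ hz1] at this
    rw [← hw, ← hw'] at this
    exact this
  have e2 : w * conj w = 1 := by rw [Complex.mul_conj', hwn]; norm_num
  have e3 : w' * conj w' = 1 := by rw [Complex.mul_conj', hwn']; norm_num
  have e4 : 1 + conj w + conj w' = 0 := by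
    have := congrArg conj e1
    simpa only [map_add, map_one, map_zero] using this
  have hA : w ^ 2 + w + 1 = 0 := by
    linear_combination (w + 1) * e1 - (w * w') * e4 + w' * e2 + w * e3
  exact ⟨hA, by linear_combination e1 - hA⟩

open ComplexConjugate in
/-- **Four unit complex numbers summing to zero form two antipodal pairs**:
`(z₁ + z₂)(z₁ + z₃)(z₁ + z₄) = 0` (the third elementary symmetric function vanishes, being
`conj(e₁) · e₄`). [folklore] -/
theorem mul_add_eq_zero_of_add_four_eq_zero {z₁ z₂ z₃ z₄ : ℂ} (h1 : ‖z₁‖ = 1) (h2 : ‖z₂‖ = 1)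
    (h3 : ‖z₃‖ = 1) (h4 : ‖z₄‖ = 1) (h : z₁ + z₂ + z₃ + z₄ = 0) :
    (z₁ + z₂) * (z₁ + z₃) * (z₁ + z₄) = 0 := by
  have n1 : z₁ * conj z₁ = 1 := by rw [Complex.mul_conj', h1]; norm_num
  have n2 : z₂ * conj z₂ = 1 := by rw [Complex.mul_conj', h2]; norm_num
  have n3 : z₃ * conj z₃ = 1 := by rw [Complex.mul_conj', h3]; norm_num
  have n4 : z₄ * conj z₄ = 1 := by rw [Complex.mul_conj', h4]; norm_num
  have ec : conj z₁ + conj z₂ + conj z₃ + conj z₄ = 0 := by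
    have := congrArg conj h
    simpa only [map_add, map_zero] using this
  linear_combination z₁ ^ 2 * h + (z₁ * z₂ * z₃ * z₄) * ec - (z₂ * z₃ * z₄) * n1 -
    (z₁ * z₃ * z₄) * n2 - (z₁ * z₂ * z₄) * n3 - (z₁ * z₂ * z₃) * n4

/-- Character version: `χ(a) + χ(b) + χ(c) = 0` for units forces `χ(b/a)` to be a primitive
cube root of unity and `χ(c/a) = χ(b/a)²`. [cite: Aoki1983, Prop. 8.1] -/
theorem char_cube_of_add_three_eq_zero {N : ℕ} [NeZero N] (χ : DirichletCharacter ℂ N)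
    (a b c : (ZMod N)ˣ) (h : χ a + χ b + χ c = 0) :
    χ ((b * a⁻¹ : (ZMod N)ˣ) : ZMod N) ^ 2 + χ ((b * a⁻¹ : (ZMod N)ˣ) : ZMod N) + 1 = 0 ∧
      χ ((c * a⁻¹ : (ZMod N)ˣ) : ZMod N) = χ ((b * a⁻¹ : (ZMod N)ˣ) : ZMod N) ^ 2 := by
  have key := cube_of_add_three_eq_zero (DirichletCharacter.unit_norm_eq_one χ a)
    (DirichletCharacter.unit_norm_eq_one χ b) (DirichletCharacter.unit_norm_eq_one χ c) h
  simp only [Units.val_mul, map_mul, map_units_inv]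
  exact key

/-- Character version: `χ(a) + χ(b) + χ(c) + χ(d) = 0` for units forces
`(χ(a) + χ(b))(χ(a) + χ(c))(χ(a) + χ(d)) = 0`. [cite: Aoki1983, Prop. 8.2] -/
theorem char_pairs_of_add_four_eq_zero {N : ℕ} [NeZero N] (χ : DirichletCharacter ℂ N)
    (a b c d : (ZMod N)ˣ) (h : χ a + χ b + χ c + χ d = 0) :
    (χ a + χ b) * (χ a + χ c) * (χ a + χ d) = 0 :=
  mul_add_eq_zero_of_add_four_eq_zero (DirichletCharacter.unit_norm_eq_one χ a)
    (DirichletCharacter.unit_norm_eq_one χ b) (DirichletCharacter.unit_norm_eq_one χ c)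
    (DirichletCharacter.unit_norm_eq_one χ d) h

/-! ### Fibre counting for Dirichlet characters -/

/-- **Fibre counting.** For `h ∈ (ℤ/N)ˣ` of order `n` and `z` with `zⁿ = 1`, exactly `φ(N)/n`
Dirichlet characters mod `N` satisfy `χ(h) = z`:  `n · #{χ : χ(h) = z} = φ(N)` (orthogonality
applied to `∑_{j<n} (z⁻¹ χ(h))ʲ`). [folklore] -/
theorem card_filter_apply_eq {N : ℕ} [NeZero N] (h : (ZMod N)ˣ) {n : ℕ} (hn : orderOf h = n)
    (hn0 : 0 < n) {z : ℂ} (hz : z ^ n = 1) :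
    n * #{χ : DirichletCharacter ℂ N | χ (h : ZMod N) = z} = N.totient := by
  classical
  have hz0 : z ≠ 0 := fun h0 ↦ by rw [h0, zero_pow hn0.ne'] at hz; exact zero_ne_one hz
  have hhn : h ^ n = 1 := by rw [← hn]; exact pow_orderOf_eq_one h
  -- the detector
  have key : ∀ χ : DirichletCharacter ℂ N,
      ∑ j ∈ range n, (z⁻¹ * χ (h : ZMod N)) ^ j = if χ (h : ZMod N) = z then (n : ℂ) else 0 := by
    intro χ
    have hw : (z⁻¹ * χ (h : ZMod N)) ^ n = 1 := by
      rw [mul_pow, ← map_pow, ← Units.val_pow_eq_pow_val, hhn, Units.val_one, map_one, mul_one,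
        inv_pow, hz, inv_one]
    split_ifs with hχ
    · rw [hχ, inv_mul_cancel₀ hz0]
      simp
    · have hne : z⁻¹ * χ (h : ZMod N) ≠ 1 := by
        intro h1
        apply hχ
        have := congrArg (z * ·) h1
        rwa [← mul_assoc, mul_inv_cancel₀ hz0, one_mul, mul_one] at this
      rw [geom_sum_eq hne, hw, sub_self, zero_div]
  -- sum the detector over all characters in two ways
  have hsum : ∑ χ : DirichletCharacter ℂ N, ∑ j ∈ range n, (z⁻¹ * χ (h : ZMod N)) ^ j =
      (N.totient : ℂ) := by
    rw [Finset.sum_comm]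
    have hj : ∀ j ∈ range n, ∑ χ : DirichletCharacter ℂ N, (z⁻¹ * χ (h : ZMod N)) ^ j =
        if j = 0 then (N.totient : ℂ) else 0 := by
      intro j hj
      rw [Finset.mem_range] at hj
      simp_rw [mul_pow, ← map_pow, ← Units.val_pow_eq_pow_val]
      rw [← Finset.mul_sum, DirichletCharacter.sum_characters_eq]
      by_cases hj0 : j = 0
      · subst hj0; simp
      · rw [if_neg, if_neg hj0, mul_zero]
        rw [Units.val_eq_one]
        exact pow_ne_one_of_lt_orderOf hj0 (hn ▸ hj)
    rw [Finset.sum_congr rfl hj, Finset.sum_ite_eq']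
    simp [hn0]
  rw [Finset.sum_congr rfl fun χ _ ↦ key χ, Finset.sum_ite, Finset.sum_const_zero, add_zero,
    Finset.sum_const, nsmul_eq_mul] at hsum
  have h' : ((n * #{χ : DirichletCharacter ℂ N | χ (h : ZMod N) = z} : ℕ) : ℂ) =
      (N.totient : ℂ) := by
    rw [← hsum]; push_cast; ring
  exact_mod_cast h'

open Classical in
/-- Exactly `φ(d)` Dirichlet characters mod `N` factor through `d ∣ N`. [folklore] -/
theorem card_filter_factorsThrough {N d : ℕ} [NeZero N] (hd : d ∣ N) :
    #{χ : DirichletCharacter ℂ N | χ.FactorsThrough d} = d.totient := by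
  classical
  have hd0 : d ≠ 0 := by rintro rfl; exact NeZero.ne N (zero_dvd_iff.mp hd)
  haveI : NeZero d := ⟨hd0⟩
  have hset : ({χ : DirichletCharacter ℂ N | χ.FactorsThrough d} : Finset _) =
      Finset.univ.image (DirichletCharacter.changeLevel hd) := by
    ext χ
    simp only [mem_filter, mem_univ, true_and, mem_image]
    constructor
    · rintro ⟨h', χ₀, rfl⟩; exact ⟨χ₀, rfl⟩
    · rintro ⟨χ₀, rfl⟩; exact ⟨hd, χ₀, rfl⟩
  rw [hset, Finset.card_image_of_injective _ (DirichletCharacter.changeLevel_injective hd),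
    Finset.card_univ, ← Nat.card_eq_fintype_card]
  exact DirichletCharacter.card_eq_totient_of_hasEnoughRootsOfUnity ℂ d

/-- **Prescribed value, avoiding a sublevel.** If `h ∈ (ℤ/N)ˣ` has order `n`, `zⁿ = 1` and
`n φ(d) < φ(N)`, some character mod `N` with `χ(h) = z` does not factor through `d`. [folklore] -/
theorem exists_apply_eq_not_factorsThrough {N d : ℕ} [NeZero N] (hd : d ∣ N) (h : (ZMod N)ˣ)
    {n : ℕ} (hn : orderOf h = n) (hn0 : 0 < n) {z : ℂ} (hz : z ^ n = 1)
    (hlt : n * d.totient < N.totient) :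
    ∃ χ : DirichletCharacter ℂ N, χ (h : ZMod N) = z ∧ ¬ χ.FactorsThrough d := by
  classical
  by_contra hcon
  push Not at hcon
  have hsub : ({χ : DirichletCharacter ℂ N | χ (h : ZMod N) = z} : Finset _) ⊆
      ({χ : DirichletCharacter ℂ N | χ.FactorsThrough d} : Finset _) := by
    intro χ hχ
    simp only [mem_filter, mem_univ, true_and] at hχ ⊢
    exact hcon χ hχ
  have h1 := Finset.card_le_card hsub
  rw [card_filter_factorsThrough hd] at h1
  have h2 := card_filter_apply_eq h hn hn0 hz
  have : n * #{χ : DirichletCharacter ℂ N | χ (h : ZMod N) = z} ≤ n * d.totient :=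
    Nat.mul_le_mul_left n h1
  omega

/-! ### Prescribed parity and prescribed value at an element of order `3` -/

/-- The order of `-a` is `6` when `a` has order `3` (`N > 2`). [folklore] -/
theorem orderOf_neg_of_orderOf_eq_three {N : ℕ} [NeZero N] (hN : 2 < N) {a : (ZMod N)ˣ}
    (ha : orderOf a = 3) : orderOf (-a) = 6 := by
  haveI : Fact (2 < N) := ⟨hN⟩
  have h1 : orderOf (-1 : (ZMod N)ˣ) = 2 := by
    rw [orderOf_eq_prime_iff]
    refine ⟨by rw [neg_one_sq], fun h ↦ ?_⟩
    have := congrArg (fun u : (ZMod N)ˣ ↦ (u : ZMod N)) h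
    simp only [Units.val_neg, Units.val_one] at this
    exact ZMod.neg_one_ne_one this
  rw [show -a = -1 * a by rw [neg_one_mul],
    (Commute.all (-1 : (ZMod N)ˣ) a).orderOf_mul_eq_mul_orderOf_of_coprime
      (by rw [h1, ha]; decide), h1, ha]

/-- **Primitive characters with prescribed parity and prescribed cube root of unity at an
element of order `3`**, at a prime power `p^e` with `6 φ(p^(e-1)) < φ(p^e)` (all `p^e` with
`3 ∣ φ(p^e)` except `p^e = 7` and `p = 3`). [folklore] -/
theorem exists_isPrimitive_neg_one_apply_cube {p e : ℕ} (hp : p.Prime) (he : 1 ≤ e)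
    (hlt : 6 * (p ^ (e - 1)).totient < (p ^ e).totient) {a : (ZMod (p ^ e))ˣ}
    (ha : orderOf a = 3) {ε ζ : ℂ} (hε : ε = 1 ∨ ε = -1) (hζ : ζ ^ 3 = 1) :
    ∃ χ : DirichletCharacter ℂ (p ^ e), χ.IsPrimitive ∧ χ (-1) = ε ∧ χ (a : ZMod (p ^ e)) = ζ := by
  haveI : NeZero (p ^ e) := ⟨pow_ne_zero e hp.ne_zero⟩
  have hq2 : 2 < p ^ e := by
    -- `3 ∣` the order of the unit group, so the group has more than `2` elements
    by_contra hle
    push Not at hle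
    have hcard : Fintype.card (ZMod (p ^ e))ˣ ≤ 2 := by
      rw [ZMod.card_units_eq_totient]
      exact le_trans (Nat.totient_le _) hle
    have h3 : 3 ∣ Fintype.card (ZMod (p ^ e))ˣ := ha ▸ orderOf_dvd_card
    have hpos : 0 < Fintype.card (ZMod (p ^ e))ˣ := Fintype.card_pos
    omega
  have h6 := orderOf_neg_of_orderOf_eq_three hq2 ha
  have hz : (ε * ζ) ^ 6 = 1 := by
    rw [mul_pow, show (6 : ℕ) = 3 * 2 by norm_num, pow_mul ζ, hζ, one_pow, mul_one]
    rcases hε with rfl | rfl <;> norm_num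
  obtain ⟨χ, hχ, hnf⟩ := exists_apply_eq_not_factorsThrough (pow_dvd_pow p (Nat.sub_le e 1))
    (-a) h6 (by norm_num) hz hlt
  refine ⟨χ, isPrimitive_of_not_factorsThrough_primePow hp he χ hnf, ?_, ?_⟩
  · -- `χ(-1) = χ((-a)^3) = (εζ)^3 = ε`
    have hx3 : (a : ZMod (p ^ e)) ^ 3 = 1 := by
      have ha3 : a ^ 3 = 1 := by rw [← ha]; exact pow_orderOf_eq_one a
      have := congrArg (fun u : (ZMod (p ^ e))ˣ ↦ (u : ZMod (p ^ e))) ha3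
      simpa using this
    have h3 : (-(a : ZMod (p ^ e))) ^ 3 = -1 := by rw [neg_pow, hx3]; norm_num
    rw [Units.val_neg] at hχ
    calc χ (-1) = χ ((-(a : ZMod (p ^ e))) ^ 3) := by rw [h3]
      _ = (ε * ζ) ^ 3 := by rw [map_pow, hχ]
      _ = ε := by
        rw [mul_pow, hζ, mul_one]
        rcases hε with rfl | rfl <;> norm_num
  · -- `χ(a) = χ((-a)^4) = (εζ)^4 = ζ`
    have hx3 : (a : ZMod (p ^ e)) ^ 3 = 1 := by
      have ha3 : a ^ 3 = 1 := by rw [← ha]; exact pow_orderOf_eq_one a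
      have := congrArg (fun u : (ZMod (p ^ e))ˣ ↦ (u : ZMod (p ^ e))) ha3
      simpa using this
    have h4 : (-(a : ZMod (p ^ e))) ^ 4 = a := by
      rw [neg_pow, show (4 : ℕ) = 3 + 1 by norm_num, pow_add (a : ZMod (p ^ e)), hx3, one_mul,
        pow_one]
      norm_num
    rw [Units.val_neg] at hχ
    calc χ (a : ZMod (p ^ e)) = χ ((-(a : ZMod (p ^ e))) ^ 4) := by rw [h4]
      _ = (ε * ζ) ^ 4 := by rw [map_pow, hχ]
      _ = ζ := by
        rw [mul_pow, show (4 : ℕ) = 3 + 1 by norm_num, pow_add ζ, hζ, one_mul, pow_one]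
        rcases hε with rfl | rfl <;> norm_num

end FermatCharacter

end Literature.AlgebraicGeometry.HodgeTheory
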